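import Literature.Geometry.Kaehler.ChartBallTransportDefectsCentreDep
import Literature.Geometry.Kaehler.L2InnerTransport
import Literature.NumberTheory.Transcendental.KaehlerHodgePreHilbert
import HarnessLib

/-!
# `L²` comparison between the central fibre and the nearby fibres of the chart-ball trivialisation — DEPENDENT fibre
# diffeomorphisms (Voisin I §9.3.2, soft form — step (D) of the continuity of the harmonic projector family)

Layer `Literature/Geometry/Kaehler`; one theorem, no definition, no named fact.  Prover seat `hodge-nonav-19716-p2` (g11,
cell `hodge-nonav`), brick **K1-2** of prover-Bx's programme «GRIFFITHS-HOLOMORPHY» in the form its consumer (K7) can apply: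
`ChartBallL2Comparison.exists_radius_re_cl2Inner_pullback_le` takes a TOTAL family `e : ∀ p : EB, X s₀ ≅ X (c⁻¹ p)`, but clause
(4) of `IsProperHolomorphicSubmersion.exists_chartBall_trivialisation` (the only producer) gives a DEPENDENT family
`e : ∀ p ∈ ball (c s₀) r, X s₀ ≅ X (c⁻¹ p)` (a total one need not exist).  This file re-proves the theorem with the dependent
binders `(e : ∀ p ∈ ball (c s₀) r, …)`, `(he : ∀ p (hp : p ∈ ball) x, ι (c⁻¹ p) (e p hp x) = Φ p x)`.  The orientation fields
`o z` stay TOTAL in `z` (the type of orientation fields of `X (c⁻¹ z)` is inhabited for every `z`; off the ball `o z` is junk) and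
their two properties (transport from `o₀` along `e z hz`, smooth volume form) are asserted for `z ∈ ball (c s₀) r` only.
* **`exists_radius_re_cl2Inner_pullback_le_dep`** — orientations `o z` (compatible with `D(e z hz)`, smooth volume forms on the
  ball) and a radius `0 < r₁ ≤ r` such that for `z ∈ ball (c s₀) r` with `z ∈ ball (c s₀) r₁` and every smooth complex `k`-form
  `α` on `X (c⁻¹ z)`: `Re (e^*α, e^*α)_{L²(X s₀)} ≤ 2 Re (α, α)_{L²(X (c⁻¹ z))}` and conversely, `e = e z hz`.  Proof = the proof
  of `exists_radius_re_cl2Inner_pullback_le` fed `eventually_transport_defects_le_centre_dep`.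
HONEST FRAMING: an analytic brick; nothing here says HC or any rung is proved.

## References
* [VoisinHodgeI2002] C. Voisin, Hodge Theory and Complex Algebraic Geometry I (2002), §5.1.1 eq. (5.1), §9.3.2 Prop. 9.20.
* [Warner1983] F. Warner, Foundations of Differentiable Manifolds and Lie Groups (1983), 4.8 (change of variables).
-/

noncomputable section

open scoped Manifold ContDiff Topology InnerProductSpace
open Bundle Module Set Filter Function Metric
open Literature.Geometry.Manifold Literature.NumberTheory.Transcendental Literature.AlgebraicGeometry.Motives

namespace Literature.Geometry.Kaehler

-- The identification `TangentSpace I x = E` is an abuse of definitional equality; as in the tree's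
-- tangent-bundle files we let `isDefEq` unfold it.
set_option backward.isDefEq.respectTransparency false

universe u

section ChartBall

variable {EX : Type u} [NormedAddCommGroup EX] [NormedSpace ℂ EX] [FiniteDimensional ℂ EX]
  [MeasurableSpace EX] [BorelSpace EX]
  {E𝒳 : Type u} [NormedAddCommGroup E𝒳] [NormedSpace ℂ E𝒳] [FiniteDimensional ℂ E𝒳]
  {𝒳 : Type u} [TopologicalSpace 𝒳] [ChartedSpace E𝒳 𝒳] [IsManifold 𝓘(ℂ, E𝒳) ω 𝒳]
  [IsManifold 𝓘(ℝ, E𝒳) ∞ 𝒳]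
  {EB : Type u} [NormedAddCommGroup EB] [NormedSpace ℂ EB]
  {B : Type u} [TopologicalSpace B] [ChartedSpace EB B]
  {proj : 𝒳 → B}
  (G : ContMDiffRiemannianMetric 𝓘(ℝ, E𝒳) ∞ E𝒳 (fun y : 𝒳 ↦ TangentSpace 𝓘(ℝ, E𝒳) y))
  {X : B → Type u} [∀ b, TopologicalSpace (X b)] [∀ b, ChartedSpace EX (X b)]
  [∀ b, IsManifold 𝓘(ℂ, EX) ω (X b)] [∀ b, IsManifold 𝓘(ℝ, EX) ∞ (X b)]
  [∀ b, CompactSpace (X b)] [∀ b, T2Space (X b)]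
  {ι : ∀ b, X b → 𝒳}

/-- **Uniform `L²` comparison between the central fibre and the nearby fibres, dependent fibre diffeomorphisms** (step (D) of
the continuity of the harmonic projector family; `exists_radius_re_cl2Inner_pullback_le` with `e : ∀ p ∈ ball, …` as produced by
clause (4) of `exists_chartBall_trivialisation`; see the module docstring).  [cite: VoisinHodgeI2002, §9.3.2 Prop. 9.20] [cite: Warner1983, 4.8] -/
theorem exists_radius_re_cl2Inner_pullback_le_dep {O : Set B} (hι : ∀ b ∈ O, IsFibreEmbedding EX E𝒳 proj b (ι b))
    (g : ∀ b, ContMDiffRiemannianMetric 𝓘(ℝ, EX) ∞ EX (fun x : X b ↦ TangentSpace 𝓘(ℝ, EX) x))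
    (hg : ∀ b ∈ O, ∀ (x : X b) (v w : TangentSpace 𝓘(ℝ, EX) x), (g b).inner x v w =
      G.inner (ι b x) (mfderiv 𝓘(ℝ, EX) 𝓘(ℝ, E𝒳) (ι b) x v) (mfderiv 𝓘(ℝ, EX) 𝓘(ℝ, E𝒳) (ι b) x w))
    {s₀ : B} {r : ℝ} {Φ : EB → X s₀ → 𝒳}
    (hbO : ∀ p ∈ ball (extChartAt 𝓘(ℂ, EB) s₀ s₀) r, (extChartAt 𝓘(ℂ, EB) s₀).symm p ∈ O)
    (hΦs : ContMDiffOn (𝓘(ℝ, EB).prod 𝓘(ℝ, EX)) 𝓘(ℝ, E𝒳) ∞ (uncurry Φ)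
      (ball (extChartAt 𝓘(ℂ, EB) s₀ s₀) r ×ˢ univ))
    (e : ∀ p ∈ ball (extChartAt 𝓘(ℂ, EB) s₀ s₀) r, X s₀ ≃ₘ^∞⟮𝓘(ℝ, EX), 𝓘(ℝ, EX)⟯ X ((extChartAt 𝓘(ℂ, EB) s₀).symm p))
    (he : ∀ p (hp : p ∈ ball (extChartAt 𝓘(ℂ, EB) s₀ s₀) r), ∀ x,
      ι ((extChartAt 𝓘(ℂ, EB) s₀).symm p) (e p hp x) = Φ p x)
    (hs₀ : s₀ ∈ O) (hΦ0 : ∀ x, Φ (extChartAt 𝓘(ℂ, EB) s₀ s₀) x = ι s₀ x) (hr : 0 < r) {N : ℕ} [Fact (finrank ℝ EX = N)]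
    (o₀ : (x : X s₀) → Orientation ℝ (TangentSpace 𝓘(ℝ, EX) x) (Fin N)) (k : ℕ) :
    letI : ∀ b', RiemannianBundle (fun x : X b' ↦ TangentSpace 𝓘(ℝ, EX) x) := fun b' ↦ ⟨(g b').toRiemannianMetric⟩
    IsSmoothForm (riemannianVolumeForm o₀) →
    ∀ (b : ∀ x : X s₀, OrthonormalBasis (Fin N) ℝ (TangentSpace 𝓘(ℝ, EX) x)), (∀ x, (b x).toBasis.orientation = o₀ x) →
    ∃ o : ∀ z : EB, (y : X ((extChartAt 𝓘(ℂ, EB) s₀).symm z)) → Orientation ℝ (TangentSpace 𝓘(ℝ, EX) y) (Fin N),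
      (∀ z (hz : z ∈ ball (extChartAt 𝓘(ℂ, EB) s₀ s₀) r) x,
        Orientation.map (Fin N) ((e z hz).mfderivToContinuousLinearEquiv (by simp) x).toLinearEquiv (o₀ x) = o z (e z hz x)) ∧
      (∀ z ∈ ball (extChartAt 𝓘(ℂ, EB) s₀ s₀) r, IsSmoothForm (riemannianVolumeForm (o z))) ∧
      ∃ r₁ : ℝ, 0 < r₁ ∧ r₁ ≤ r ∧ ∀ z (hz : z ∈ ball (extChartAt 𝓘(ℂ, EB) s₀ s₀) r),
        z ∈ ball (extChartAt 𝓘(ℂ, EB) s₀ s₀) r₁ →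
        ∀ (α₁ : MForm 𝓘(ℝ, EX) (X ((extChartAt 𝓘(ℂ, EB) s₀).symm z)) ℂ k), IsSmoothForm α₁ →
          (MForm.cl2Inner o₀ (α₁.pullback 𝓘(ℝ, EX) (e z hz)) (α₁.pullback 𝓘(ℝ, EX) (e z hz))).re ≤
              2 * (MForm.cl2Inner (o z) α₁ α₁).re ∧
          (MForm.cl2Inner (o z) α₁ α₁).re ≤
              2 * (MForm.cl2Inner o₀ (α₁.pullback 𝓘(ℝ, EX) (e z hz)) (α₁.pullback 𝓘(ℝ, EX) (e z hz))).re := by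
  letI iX : ∀ b', RiemannianBundle (fun x : X b' ↦ TangentSpace 𝓘(ℝ, EX) x) := fun b' ↦ ⟨(g b').toRiemannianMetric⟩
  intro ho₀ b hb
  haveI : ∀ b', IsContMDiffRiemannianBundle 𝓘(ℝ, EX) ∞ EX (fun x : X b' ↦ TangentSpace 𝓘(ℝ, EX) x) :=
    fun b' ↦ ⟨(g b').inner, (g b').contMDiff, fun _ _ _ ↦ rfl⟩
  haveI : ∀ b', IsContinuousRiemannianBundle EX (fun x : X b' ↦ TangentSpace 𝓘(ℝ, EX) x) :=
    fun b' ↦ ⟨(g b').inner, (g b').contMDiff.continuous, fun _ _ _ ↦ rfl⟩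
  -- ### orientations of the fibres, transported from `o₀` along `e z hz` on the ball (junk off the ball)
  have hEX : finrank ℝ EX = N := Fact.out
  have ho₀c : IsContinuousOrientation (I := 𝓘(ℝ, EX)) o₀ :=
    isContinuousOrientation_of_isSmoothForm_riemannianVolumeForm_holds o₀ ho₀
  have hoex := fun (z : EB) (hz : z ∈ ball (extChartAt 𝓘(ℂ, EB) s₀ s₀) r) ↦
    exists_orientation_transport (n := N) (e z hz) o₀
  choose o' hΦo hcompat using hoex
  classical
  obtain ⟨o, ho_def⟩ : ∃ o : ∀ z : EB,
      (y : X ((extChartAt 𝓘(ℂ, EB) s₀).symm z)) → Orientation ℝ (TangentSpace 𝓘(ℝ, EX) y) (Fin N),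
      ∀ z (hz : z ∈ ball (extChartAt 𝓘(ℂ, EB) s₀ s₀) r), o z = o' z hz :=
    ⟨fun z ↦ if hz : z ∈ ball (extChartAt 𝓘(ℂ, EB) s₀ s₀) r then o' z hz
      else fun _ ↦ (Module.finBasisOfFinrankEq ℝ EX hEX).orientation, fun z hz ↦ dif_pos hz⟩
  have hoc : ∀ z (hz : z ∈ ball (extChartAt 𝓘(ℂ, EB) s₀ s₀) r), IsContinuousOrientation (I := 𝓘(ℝ, EX)) (o z) :=
    fun z hz ↦ by
    rw [ho_def z hz]
    exact isContinuousOrientation_of_orientationMap (o' z hz) o₀ ho₀c (e z hz).symm.contMDiff (hcompat z hz)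
  have ho : ∀ z ∈ ball (extChartAt 𝓘(ℂ, EB) s₀ s₀) r, IsSmoothForm (riemannianVolumeForm (o z)) := fun z hz ↦
    isSmoothForm_riemannianVolumeForm_of_isContinuousOrientation_holds (o z) (hoc z hz)
  have hΦo' : ∀ z (hz : z ∈ ball (extChartAt 𝓘(ℂ, EB) s₀ s₀) r) x,
      Orientation.map (Fin N) ((e z hz).mfderivToContinuousLinearEquiv (by simp) x).toLinearEquiv (o₀ x) = o z (e z hz x) :=
    fun z hz x ↦ by rw [ho_def z hz]; exact hΦo z hz x
  refine ⟨o, hΦo', ho, ?_⟩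
  -- ### the radius: every `e z hz`, `z` near `c s₀`, is a `δ₀`-almost isometry of `(X s₀, g s₀)`
  obtain ⟨δ₀, hδ₀, hR⟩ := exists_forall_norm_cl2Inner_transport_sub_le o₀ ho₀ b hb k (ε := 1 / 8) (by norm_num)
  have hev := eventually_transport_defects_le_centre_dep G hι g hg hbO hΦs e he hs₀ hΦ0 hr hδ₀ b
  obtain ⟨r₁, hr₁, hball⟩ := Metric.eventually_nhds_iff_ball.1 hev
  refine ⟨min r₁ r, lt_min hr₁ hr, min_le_right _ _, fun z hz hz₁ α₁ hω ↦ ?_⟩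
  obtain ⟨hzD, hT, -⟩ := hball z (ball_subset_ball (min_le_left _ _) hz₁)
  -- the transported form `a = e^* ω` on the central fibre, and `(e⁻¹)^* a = ω`, `e = e z hz`
  set a : MForm 𝓘(ℝ, EX) (X s₀) ℂ k := α₁.pullback 𝓘(ℝ, EX) (e z hz) with ha
  have has : IsSmoothForm a := isSmoothForm_pullback (e z hz).contMDiff hω
  have hpb : a.pullback 𝓘(ℝ, EX) (e z hz).symm = α₁ := by
    rw [ha, ← MForm.pullback_comp ((e z hz).mdifferentiable (by simp)) ((e z hz).symm.mdifferentiable (by simp))]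
    have : (((e z hz) : X s₀ → _) ∘ ((e z hz).symm : _ → X s₀)) = id :=
      funext fun y ↦ (e z hz).apply_symm_apply y
    rw [this, MForm.pullback_id]
  have key := hR (o z) (ho z hz) (e z hz) (hΦo' z hz) hδ₀.le le_rfl hT has has
  rw [hpb] at key
  -- real parts
  set A := (MForm.cl2Inner o₀ a a).re with hA
  set Bz := (MForm.cl2Inner (o z) α₁ α₁).re with hBz
  have hA0 : 0 ≤ A := has.re_cl2Inner_self_nonneg o₀ ho₀
  have hdiff : |Bz - A| ≤ 2 * (1 / 8) * (A + A) := by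
    have h1 : |Bz - A| = |(MForm.cl2Inner (o z) α₁ α₁ - MForm.cl2Inner o₀ a a).re| := by
      rw [Complex.sub_re]
    rw [h1]
    exact (Complex.abs_re_le_norm _).trans key
  have h2 : |Bz - A| ≤ A / 2 := by linarith
  obtain ⟨h3, h4⟩ := abs_le.1 h2
  exact ⟨by linarith, by linarith⟩

end ChartBall

end Literature.Geometry.Kaehler

end
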